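import Literature.Algebra.Homology.FreeAbelianCohomologyEigenbasis
import Literature.Algebra.Homology.GroupCohomologyInnerAutomorphism
import Literature.Algebra.Homology.GroupCohomologySemilinear
import Mathlib.RepresentationTheory.Homological.GroupCohomology.LongExactSequence
import Mathlib.RepresentationTheory.Homological.GroupCohomology.Shapiro
import Mathlib.RingTheory.OrzechProperty
import Mathlib.RingTheory.FiniteType
import Mathlib.Algebra.Exact.Basic
import HarnessLib

/-!
# `Hⁿ(ℤ^d, k)` is free of rank `(d choose n)` over ANY commutative ring `k`, with basis the cup
# products of coordinate characters, detected by the alternating pairing (Brown V §6 over `ℤ`)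

Topic `Algebra/Homology`; namespace `Literature.Algebra.Homology`.  Definitions with bodies and
theorems; NO named fact, no `sorry`.  Mathlib (`groupCohomology`, its long exact sequence
`mapShortComplex₁/₂/₃`, Shapiro's lemma `coindIso`, `OrzechProperty`) + the tree's
`InfiniteCyclicQuotientCohomology` (the shift sequence `0 → A → Coind_H^G Res A → Coind → 0`,
`shortExact_shiftComplex`), `GroupCohomologyInnerAutomorphism` (`map_eq_id_of_conj`: inner
automorphisms act trivially), `FreeAbelianCohomologyEigenbasis` (the poly-`ℤ` chain `zpowSpan b i` of a
based commutative group, `subsetEmb`), `GroupCohomologySemilinear` (`π_apply_eq_π_apply_iff`,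
`iCocycles_toCocycles`).

Motivation (lane `lit-hodgefound`, Layer A, seat p30 gen 5): the last sentence of Lange 2023, §1.1.6
Exercise (13) — "Actually there are canonical isomorphisms `φ_n : Hⁿ(Λ, ℤ) → Hⁿ(X, ℤ)` for all `n`"
for a complex torus `X = V/Λ` [cite: Lange2023AbelianVarietiesComplex, §1.1.6 Ex. (13)] — needs the
group cohomology of the lattice `Λ ≅ ℤ^{2g}` with INTEGER coefficients in every degree.  The sibling
`FreeAbelianCohomologyEigenbasis` proves `H•(ℤ^d, k) = ⋀•(k^d)` for a FIELD `k` by a dimension count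
(linear independence by alternating evaluation + the Wang inequalities); over `ℤ` a dimension count
only gives a finite-index sublattice, so this file replaces it by EXACT sequences:

* §1 **The Wang sequence splits for trivial coefficients of a commutative group.**  For `H ≤ G`
  with `G/H` infinite cyclic generated by `t`, the shift `S f (x) = t⁻¹ f(t x)` of `Coind_H^G Res_H A`
  IS the action of `t` on the coinduced module when `G` is commutative and `A` is trivial
  (`shiftHom_hom_apply_eq_ρ`), hence induces the identity of `Hⁿ(G, Coind)` (`map_shiftHom_eq_id`,
  by `map_eq_id_of_conj` — Brown III (8.3), the pair `(h ↦ t⁻¹ h t = h, ρ(t))`); so `Hⁿ(G, S − 𝟙) = 0`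
  and the long exact sequence of `0 → A → Coind → Coind → 0` breaks into the short exact sequences
  `0 → Hⁿ(G, Coind) → Hⁿ⁺¹(G, A) → Hⁿ⁺¹(G, Coind) → 0` (`wang_injective_surjective_exact`), i.e.,
  with Shapiro, `Hⁿ⁺¹(G, A) ≃ Hⁿ(H, A) × Hⁿ⁺¹(H, A)` as soon as `Hⁿ⁺¹(H, A)` is projective
  (`nonempty_linearEquiv_prod_wang`) — the case `G = H × ℤ` of the Künneth formula
  [Brown1982CohomologyGroups, V (5.8)] obtained resolution-free.
* §2 **`Hⁿ(G, k) ≃ₗ[k] k^{(d choose n)}`** for a commutative `G` with a `ℤ`-basis `b : Fin d → G`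
  (`hgen`: every element is `∏ b_l^{m_l}`; `hind`: uniquely) and ANY commutative `k`
  (`nonempty_linearEquiv_finArrow`; induction along `zpowSpan b i` with Pascal's rule).
* §3 the cup-product cochains `charCupCochain θ (g) = ∏ᵢ θᵢ(gᵢ)` of additive characters (cocycles,
  `d_charCupCochain`; classes `charCupClass θ ∈ Hⁿ(G, k)`; multilinear in `θ`) and the alternating
  pairing `altPairing g f = ∑_σ sgn(σ) f(g ∘ σ)` with a tuple `g₁ ∧ ⋯ ∧ gₙ` (kills coboundaries at
  commuting tuples, `altPairing_d_eq_zero`; `⟨θ₁ ∪ ⋯ ∪ θₙ, g⟩ = det (θᵢ(g_a))`,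
  `altPairing_charCupCochain`; `= δ_{IJ}` on dual data, `altPairing_charCupCochain_dual`) — for
  `Rep.trivial k G k` over an ARBITRARY commutative ring `k`.  The tree's `prodCochain` / `altEval` of
  `ProductCocycles` / `AlternatingCochainEvaluation` are the same formulas stated for `[Field k]`
  (`trivRep`); nothing landed is restated on its own carrier.
  -- TODO(general form): derive the `[Field k]` lemmas of `ProductCocycles` /
  -- `AlternatingCochainEvaluation` from the present ring-general ones.
* §4 for `G` commutative: the pairing descends to **`altPairingClass g : Hⁿ(G, k) →ₗ[k] k`**
  (`altPairingClass_π`), the evaluation **`altPairingHom b n : Hⁿ(G, k) →ₗ[k] k^{(n-subsets of [d])}`**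
  at the increasing basis tuples is SURJECTIVE given characters `θ'` dual to `b` (dual cup classes go
  to the standard basis, `altPairingHom_dualCupClass`) and hence BIJECTIVE (`altPairingHom_bijective`:
  a surjection onto a module abstractly isomorphic to the finitely generated source is injective,
  `OrzechProperty`) — **`altPairingEquiv`**; the `(d choose n)` dual cup classes
  `[θ'_{s₁} ∪ ⋯ ∪ θ'_{sₙ}]` are a **`Module.Basis`** of `Hⁿ(G, k)` (`dualCupBasis`, coordinates =
  alternating evaluations, `dualCupBasis_repr_apply`); `Hⁿ(G, k)` is free, finitely generated, of
  rank `(d choose n)` (`free_groupCohomology`, `finrank_groupCohomology`).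
* §5 the coordinate characters `coordChar b : θⱼ(∏ b_l^{m_l}) = m_j` (dual to `b`) exist, so all of
  §4 holds with no auxiliary data (`coordCupBasis`, `free_and_finrank_groupCohomology`).

For `k = ℤ`, `G = ℤ^d` this is the integral statement `H•(ℤ^d, ℤ) = ⋀•(ℤ^d)^∨` with its monomial
basis — Brown's Theorem V.6.4 (for `k` a PID and `G` torsion-free the Pontryagin algebra map
`ψ : ⋀•(G ⊗ k) → H•(G, k)` is an isomorphism), read on cohomology through the pairing with the
Pontryagin products `g₁ ∧ ⋯ ∧ gₙ`; Brown proves it with the Künneth formula for `G₁ × G₂`, here the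
`ℤ`-by-`ℤ` layers are split by §1 instead.  The complex-torus junction (`φ_n` itself, values in the
lane's `integralForms Φ n`) is the sibling `Literature/Geometry/Kaehler/ComplexTorusLatticeGroupCohomologyAllDegrees`.

## References
* K. S. Brown, *Cohomology of Groups*, GTM 87 (1982): III (8.3) (conjugation acts trivially),
  V §3 (cup products), V (5.8) (Künneth), V §6 Thm. 6.4 and p. 129 (monomial basis of `⋀`)
  [Brown1982CohomologyGroups] — held copy `book:brown1982-cohomology-groups`, chunks p0126–p0130.
* H. Lange, *Abelian Varieties over the Complex Numbers*, Springer (2023), §1.1.6 Exercise (13)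
  [Lange2023AbelianVarietiesComplex] — held copy `book:lange1992-complex-abelian-varieties`, chunk p0028.
-/

noncomputable section

open CategoryTheory CategoryTheory.Limits groupCohomology

universe u

namespace Literature.Algebra.Homology

/-! ### §1 The Wang sequence splits for trivial coefficients of a commutative group -/

section WangSplit

variable {k G : Type u} [CommRing k] [CommGroup G] (H : Subgroup G) (A : Rep.{u} k G) [A.IsTrivial]
  (t : G)

/-- For a commutative group and TRIVIAL coefficients the shift `(S f)(x) = t⁻¹ f(t x)` of
`Coind_H^G Res_H A` is the action of `t` itself: `S f = ρ(t) f`. [cite: Brown1982CohomologyGroups, VIII §2 and III (8.3)] -/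
theorem shiftHom_hom_apply_eq_ρ (f : coindRes H A) :
    (shiftHom H A t).hom f = (coindRes H A).ρ t f := by
  refine Subtype.ext (funext fun x => ?_)
  rw [shiftHom_hom_apply_coe, coindRes_ρ_apply, Representation.isTrivial_apply, mul_comm]

/-- **The shift induces the identity on `Hⁿ(G, Coind)`** (it is the action of the element `t`,
and inner automorphisms act trivially on cohomology, Brown III (8.3); here the group is commutative
so the inner automorphism is the identity of `G`). [cite: Brown1982CohomologyGroups, III (8.3)] -/
theorem map_shiftHom_eq_id (n : ℕ) :
    groupCohomology.map (A := coindRes H A) (B := coindRes H A) (MonoidHom.id G) (shiftHom H A t) n =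
      𝟙 _ :=
  map_eq_id_of_conj (coindRes H A) t (f := MonoidHom.id G) (fun h => by
    rw [MonoidHom.id_apply, mul_comm t⁻¹ h, mul_assoc, inv_mul_cancel, mul_one])
    (shiftHom H A t) (fun f => shiftHom_hom_apply_eq_ρ H A t f) n

/-- The same through Mathlib's functor `Hⁿ(G, −)`. [cite: Brown1982CohomologyGroups, III (8.3)] -/
theorem functor_map_shiftHom_eq_id (n : ℕ) :
    (groupCohomology.functor k G n).map (shiftHom H A t) = 𝟙 _ :=
  map_shiftHom_eq_id H A t n

/-- Hence `Hⁿ(G, S − 𝟙) = 0`. [cite: Brown1982CohomologyGroups, III (8.3)] -/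
theorem map_shiftComplex_g_eq_zero (n : ℕ) :
    groupCohomology.map (A := coindRes H A) (B := coindRes H A) (MonoidHom.id G)
      (shiftComplex H A t).g n = 0 := by
  rw [shiftComplex_g]
  have hadd : (cochainsFunctor k G).map (shiftHom H A t - 𝟙 (coindRes H A)) =
      (cochainsFunctor k G).map (shiftHom H A t) - (cochainsFunctor k G).map (𝟙 (coindRes H A)) :=
    (cochainsFunctor k G).map_sub
  change HomologicalComplex.homologyMap ((cochainsFunctor k G).map (shiftHom H A t - 𝟙 (coindRes H A))) n = 0
  rw [hadd, HomologicalComplex.homologyMap_sub, (cochainsFunctor k G).map_id, HomologicalComplex.homologyMap_id,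
    sub_eq_zero]
  exact map_shiftHom_eq_id H A t n

/-- **Extensions by a projective module split** (linear algebra): for `M → N → P` exact with
`M → N` injective, `N → P` surjective and `P` projective, `N ≃ M × P`. [folklore] -/
private theorem nonempty_linearEquiv_prod_of_exact {M N P : Type*} [AddCommGroup M] [Module k M]
    [AddCommGroup N] [Module k N] [AddCommGroup P] [Module k P] [Module.Projective k P]
    (f : M →ₗ[k] N) (g : N →ₗ[k] P) (hf : Function.Injective f) (hg : Function.Surjective g)
    (hfg : Function.Exact f g) : Nonempty (N ≃ₗ[k] M × P) := by
  obtain ⟨l, hl⟩ := Module.projective_lifting_property g LinearMap.id hg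
  exact ⟨(hfg.splitSurjectiveEquiv hf ⟨l, hl⟩).1⟩

variable (hgen : ∀ g : G, ∃ (x : H) (m : ℤ), g = (x : G) * t ^ m) (hfree : ∀ m : ℤ, t ^ m ∈ H → m = 0)

include hgen hfree in
/-- **The Wang sequence splits into short exact sequences** `0 → Hⁿ(G, Coind) → Hⁿ⁺¹(G, A) →
Hⁿ⁺¹(G, Coind) → 0` (`G` commutative, `A` trivial, `G/H` infinite cyclic generated by `t`): the
connecting map is injective, `Hⁿ⁺¹` of the constant embedding is surjective, and the pair is exact.
[cite: Brown1982CohomologyGroups, III (8.3) and VIII §2] -/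
theorem wang_injective_surjective_exact (n : ℕ) :
    Function.Injective (mapShortComplex₁ (shortExact_shiftComplex H A t hgen hfree) (rfl : n + 1 = n + 1)).f.hom ∧
    Function.Surjective (mapShortComplex₁ (shortExact_shiftComplex H A t hgen hfree) (rfl : n + 1 = n + 1)).g.hom ∧
    Function.Exact (mapShortComplex₁ (shortExact_shiftComplex H A t hgen hfree) (rfl : n + 1 = n + 1)).f.hom
      (mapShortComplex₁ (shortExact_shiftComplex H A t hgen hfree) (rfl : n + 1 = n + 1)).g.hom := by
  have hX := shortExact_shiftComplex H A t hgen hfree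
  refine ⟨?_, ?_, ?_⟩
  · -- `δ` is a monomorphism since `Hⁿ(S − 𝟙) = 0` before it
    have h3 := mapShortComplex₃_exact hX (rfl : n + 1 = n + 1)
    have hf0 : (mapShortComplex₃ hX (rfl : n + 1 = n + 1)).f = 0 := map_shiftComplex_g_eq_zero H A t n
    have hm : Mono (mapShortComplex₃ hX (rfl : n + 1 = n + 1)).g := h3.mono_g hf0
    exact (ModuleCat.mono_iff_injective _).1 hm
  · -- `Hⁿ⁺¹(ι)` is an epimorphism since `Hⁿ⁺¹(S − 𝟙) = 0` after it
    have h2 := mapShortComplex₂_exact hX (n + 1)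
    have hg0 : (mapShortComplex₂ (shiftComplex H A t) (n + 1)).g = 0 := map_shiftComplex_g_eq_zero H A t (n + 1)
    have he : Epi (mapShortComplex₂ (shiftComplex H A t) (n + 1)).f := h2.epi_f hg0
    exact (ModuleCat.epi_iff_surjective _).1 he
  · exact (ShortComplex.ShortExact.moduleCat_exact_iff_function_exact _).1 (mapShortComplex₁_exact hX rfl)

include hgen hfree in
/-- **`Hⁿ⁺¹(G, A) ≃ Hⁿ(H, A) × Hⁿ⁺¹(H, A)`** (non-canonically) for `G` commutative, `A` trivial, `G/H`
infinite cyclic, whenever `Hⁿ⁺¹(H, A)` is projective over `k` — the split Wang sequence composed with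
Shapiro's isomorphisms `Hⁱ(G, Coind_H^G Res A) ≅ Hⁱ(H, Res A)`. [cite: Brown1982CohomologyGroups, VIII §2] -/
theorem nonempty_linearEquiv_prod_wang (n : ℕ)
    [Module.Projective k (groupCohomology (Rep.res H.subtype A) (n + 1))] :
    Nonempty (groupCohomology A (n + 1) ≃ₗ[k]
      groupCohomology (Rep.res H.subtype A) n × groupCohomology (Rep.res H.subtype A) (n + 1)) := by
  obtain ⟨hinj, hsurj, hex⟩ := wang_injective_surjective_exact H A t hgen hfree n
  let f' : groupCohomology (coindRes H A) n →ₗ[k] groupCohomology A (n + 1) :=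
    (mapShortComplex₁ (shortExact_shiftComplex H A t hgen hfree) (rfl : n + 1 = n + 1)).f.hom
  let g' : groupCohomology A (n + 1) →ₗ[k] groupCohomology (coindRes H A) (n + 1) :=
    (mapShortComplex₁ (shortExact_shiftComplex H A t hgen hfree) (rfl : n + 1 = n + 1)).g.hom
  have hinj' : Function.Injective f' := hinj
  have hsurj' : Function.Surjective g' := hsurj
  have hex' : Function.Exact f' g' := hex
  let eₙ : groupCohomology (coindRes H A) n ≃ₗ[k] groupCohomology (Rep.res H.subtype A) n :=
    (groupCohomology.coindIso (Rep.res H.subtype A) n).toLinearEquiv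
  let eₙ₁ : groupCohomology (coindRes H A) (n + 1) ≃ₗ[k] groupCohomology (Rep.res H.subtype A) (n + 1) :=
    (groupCohomology.coindIso (Rep.res H.subtype A) (n + 1)).toLinearEquiv
  haveI : Module.Projective k (groupCohomology (coindRes H A) (n + 1)) := Module.Projective.of_equiv eₙ₁.symm
  obtain ⟨e⟩ := nonempty_linearEquiv_prod_of_exact f' g' hinj' hsurj' hex'
  exact ⟨e.trans (eₙ.prodCongr eₙ₁)⟩

end WangSplit

/-! ### §2 `Hⁿ(ℤ^d, k)` is free of rank `(d choose n)` -/

section Rank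

variable {k : Type u} [CommRing k]

/-- `H⁰(Γ, k) ≃ k¹` for trivial coefficients. [folklore] -/
def linearEquivH0Trivial (Γ : Type u) [Group Γ] :
    groupCohomology (Rep.trivial k Γ k) 0 ≃ₗ[k] (Fin 1 → k) :=
  (groupCohomology.H0IsoOfIsTrivial (Rep.trivial k Γ k)).toLinearEquiv.trans (LinearEquiv.funUnique (Fin 1) k k).symm

/-- A zero object of `ModuleCat k` is `≃ k⁰`. [folklore] -/
def linearEquivOfIsZero {M : ModuleCat.{u} k} (h : IsZero M) : M ≃ₗ[k] (Fin 0 → k) :=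
  (h.iso (ModuleCat.isZero_of_subsingleton (ModuleCat.of k (Fin 0 → k)))).toLinearEquiv

/-- Transport of `Hⁿ(−, k)` (trivial coefficients) along a group isomorphism. [folklore] -/
def linearEquivOfMulEquiv {Γ Γ' : Type u} [Group Γ] [Group Γ'] (e : Γ ≃* Γ') (n : ℕ) :
    groupCohomology (Rep.trivial k Γ' k) n ≃ₗ[k] groupCohomology (Rep.trivial k Γ k) n :=
  (groupCohomology.mapIso (A := Rep.trivial k Γ' k) (B := Rep.trivial k Γ k) e (LinearEquiv.refl k k)
    (fun _ => rfl) n).toLinearEquiv.symm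

/-- `k^a × k^b ≃ k^c` for `c = a + b`. [folklore] -/
def finArrowProdEquiv (a b c : ℕ) (h : c = a + b) : ((Fin a → k) × (Fin b → k)) ≃ₗ[k] (Fin c → k) :=
  (LinearEquiv.sumArrowLequivProdArrow (Fin a) (Fin b) k k).symm.trans
    (LinearEquiv.funCongrLeft k k ((finCongr h).trans finSumFinEquiv.symm))

variable {G : Type u} [CommGroup G] {d : ℕ} (b : Fin d → G)
  (hind : ∀ m : Fin d → ℤ, ∏ l, b l ^ m l = 1 → m = 0)

/-- `zpowSpan b 0` is the trivial group. [folklore] -/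
private theorem subsingleton_zpowSpan_zero : Subsingleton (zpowSpan b 0) := by
  rw [zpowSpan_zero]
  exact ⟨fun x y => Subtype.ext ((Subgroup.mem_bot.1 x.2).trans (Subgroup.mem_bot.1 y.2).symm)⟩

include hind in
/-- **Rank induction along `⟨b₁, …, bᵢ⟩`**: `Hⁿ(zpowSpan b i, k) ≃ k^{(i choose n)}` for `i ≤ d`
(trivial coefficients; the split Wang sequences of §1 and Pascal's rule).
[cite: Brown1982CohomologyGroups, V §6] -/
theorem nonempty_linearEquiv_zpowSpan :
    ∀ i, i ≤ d → ∀ n, Nonempty (groupCohomology (Rep.trivial k (zpowSpan b i) k) n ≃ₗ[k] (Fin (i.choose n) → k))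
  | 0, _, n => by
    haveI := subsingleton_zpowSpan_zero b
    rcases n with _ | n
    · exact ⟨(linearEquivH0Trivial (zpowSpan b 0)).trans (LinearEquiv.funCongrLeft k k (finCongr (by simp)))⟩
    · exact ⟨(linearEquivOfIsZero (isZero_groupCohomology_succ_of_subsingleton (Rep.trivial k (zpowSpan b 0) k) n)).trans
        (LinearEquiv.funCongrLeft k k (finCongr (by simp)))⟩
  | i + 1, hi, n => by
    have ih := nonempty_linearEquiv_zpowSpan i (Nat.le_of_succ_le hi)
    rcases n with _ | n
    · exact ⟨(linearEquivH0Trivial (zpowSpan b (i + 1))).trans (LinearEquiv.funCongrLeft k k (finCongr (by simp)))⟩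
    · -- the layer `zpowSpan b i ≤ zpowSpan b (i+1)` with infinite cyclic quotient generated by `b i`
      have hle : zpowSpan b i ≤ zpowSpan b (i + 1) := zpowSpan_mono b (Nat.le_succ i)
      let H' : Subgroup (zpowSpan b (i + 1)) := (zpowSpan b i).subgroupOf (zpowSpan b (i + 1))
      let e : H' ≃* zpowSpan b i := Subgroup.subgroupOfEquivOfLe hle
      obtain ⟨t, ht, hgen, hfree⟩ := zpowSpan_cyclic b hind i (Nat.lt_of_succ_le hi)
      have hgen' : ∀ g : zpowSpan b (i + 1), ∃ (h : H') (m : ℤ), g = (h : zpowSpan b (i + 1)) * ⟨t, ht⟩ ^ m := by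
        intro g
        obtain ⟨h, hh, m, hg⟩ := hgen g g.2
        refine ⟨⟨⟨h, hle hh⟩, Subgroup.mem_subgroupOf.2 hh⟩, m, Subtype.ext ?_⟩
        rw [Subgroup.coe_mul, SubgroupClass.coe_zpow]
        exact hg
      have hfree' : ∀ m : ℤ, (⟨t, ht⟩ : zpowSpan b (i + 1)) ^ m ∈ H' → m = 0 := fun m hm =>
        hfree m (by simpa [H', Subgroup.mem_subgroupOf] using hm)
      -- the induction hypothesis on the layer, in both degrees
      obtain ⟨eₙ⟩ := ih n
      obtain ⟨eₙ₁⟩ := ih (n + 1)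
      let fₙ : groupCohomology (Rep.res H'.subtype (Rep.trivial k (zpowSpan b (i + 1)) k)) n ≃ₗ[k]
          (Fin (i.choose n) → k) := (linearEquivOfMulEquiv e n).symm.trans eₙ
      let fₙ₁ : groupCohomology (Rep.res H'.subtype (Rep.trivial k (zpowSpan b (i + 1)) k)) (n + 1) ≃ₗ[k]
          (Fin (i.choose (n + 1)) → k) := (linearEquivOfMulEquiv e (n + 1)).symm.trans eₙ₁
      haveI : Module.Projective k (groupCohomology (Rep.res H'.subtype (Rep.trivial k (zpowSpan b (i + 1)) k)) (n + 1)) :=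
        Module.Projective.of_equiv fₙ₁.symm
      obtain ⟨w⟩ := nonempty_linearEquiv_prod_wang H' (Rep.trivial k (zpowSpan b (i + 1)) k) ⟨t, ht⟩ hgen' hfree' n
      exact ⟨(w.trans (fₙ.prodCongr fₙ₁)).trans (finArrowProdEquiv _ _ _ (Nat.choose_succ_succ' i n))⟩

variable (hgen : ∀ g : G, ∃ m : Fin d → ℤ, g = ∏ l, b l ^ m l)

include hgen hind in
/-- **`Hⁿ(G, k) ≃ k^{(d choose n)}`** for a commutative group `G` with a `ℤ`-basis of `d` elements
and ANY commutative coefficient ring `k` with the trivial action: `H•(ℤ^d, k)` is free with the ranks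
of `⋀•(k^d)`. [cite: Brown1982CohomologyGroups, V §6] -/
theorem nonempty_linearEquiv_finArrow (n : ℕ) :
    Nonempty (groupCohomology (Rep.trivial k G k) n ≃ₗ[k] (Fin (d.choose n) → k)) := by
  have htop : zpowSpan b d = ⊤ := zpowSpan_eq_top_of_le b hgen le_rfl
  let e : zpowSpan b d ≃* G := (MulEquiv.subgroupCongr htop).trans Subgroup.topEquiv
  obtain ⟨w⟩ := nonempty_linearEquiv_zpowSpan (k := k) b hind d le_rfl n
  exact ⟨(linearEquivOfMulEquiv e n).trans w⟩

end Rank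

/-! ### §3 Cup products of additive characters and the alternating pairing (any commutative `k`) -/

section CupCochains

variable {k G : Type u} [CommRing k] [Group G]

/-- **The cup-product cochain `(θ₁ ∪ ⋯ ∪ θₙ)(g) = ∏ᵢ θᵢ(gᵢ)`** of additive characters `θᵢ : G → k`,
coefficients in an arbitrary commutative ring `k` (the `[Field k]` version is `prodCochain` of
`ProductCocycles`). [cite: Brown1982CohomologyGroups, V §3] -/
def charCupCochain {n : ℕ} (θ : Fin n → (Additive G →+ k)) : (Fin n → G) → k :=
  fun g => ∏ i, θ i (Additive.ofMul (g i))

/-- Unfolding `charCupCochain`. [cite: Brown1982CohomologyGroups, V §3] -/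
theorem charCupCochain_apply {n : ℕ} (θ : Fin n → (Additive G →+ k)) (g : Fin n → G) :
    charCupCochain θ g = ∏ i, θ i (Additive.ofMul (g i)) :=
  rfl

/-- The telescoping terms `Bⱼ(g) = ∏_{i<j} θᵢ(gᵢ) · ∏_{i≥j} θᵢ(gᵢ₊₁)` of the boundary. [folklore] -/
private def charCupAux {n : ℕ} (θ : Fin n → (Additive G →+ k)) (g : Fin (n + 1) → G) (j : ℕ) : k :=
  ∏ i : Fin n, if (i : ℕ) < j then θ i (Additive.ofMul (g (Fin.castSucc i))) else θ i (Additive.ofMul (g i.succ))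

/-- `B₀(g) = (θ₁ ∪ ⋯ ∪ θₙ)(g₁, …, gₙ)` (first face). [folklore] -/
private theorem charCupCochain_tail {n : ℕ} (θ : Fin n → (Additive G →+ k)) (g : Fin (n + 1) → G) :
    charCupCochain θ (fun i => g i.succ) = charCupAux θ g 0 := by
  simp [charCupCochain, charCupAux]

/-- `Bₙ(g) = (θ₁ ∪ ⋯ ∪ θₙ)(g₀, …, gₙ₋₁)` (last face). [folklore] -/
private theorem charCupCochain_contractNth_last {n : ℕ} (θ : Fin n → (Additive G →+ k)) (g : Fin (n + 1) → G) :
    charCupCochain θ ((Fin.last n).contractNth (· * ·) g) = charCupAux θ g n := by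
  unfold charCupCochain charCupAux
  refine Finset.prod_congr rfl fun i _ => ?_
  rw [Fin.contractNth_apply_of_lt _ _ _ _ (by simp), if_pos i.2]

/-- The inner faces: `(θ₁ ∪ ⋯ ∪ θₙ)(…, gⱼ gⱼ₊₁, …) = Bⱼ(g) + Bⱼ₊₁(g)` for `j < n`. [folklore] -/
private theorem charCupCochain_contractNth_of_lt {n : ℕ} (θ : Fin n → (Additive G →+ k)) (g : Fin (n + 1) → G)
    (j : Fin (n + 1)) (hj : (j : ℕ) < n) :
    charCupCochain θ (j.contractNth (· * ·) g) = charCupAux θ g j + charCupAux θ g (j + 1) := by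
  classical
  unfold charCupCochain charCupAux
  set j' : Fin n := ⟨j, hj⟩ with hj'
  have hjj' : (j' : ℕ) = j := rfl
  rw [← Finset.mul_prod_erase Finset.univ _ (Finset.mem_univ j'),
    ← Finset.mul_prod_erase Finset.univ (fun i : Fin n => if (i : ℕ) < (j : ℕ) then θ i (Additive.ofMul (g (Fin.castSucc i)))
      else θ i (Additive.ofMul (g i.succ))) (Finset.mem_univ j'),
    ← Finset.mul_prod_erase Finset.univ (fun i : Fin n => if (i : ℕ) < (j : ℕ) + 1 then θ i (Additive.ofMul (g (Fin.castSucc i)))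
      else θ i (Additive.ofMul (g i.succ))) (Finset.mem_univ j')]
  have hrest : ∀ i ∈ Finset.univ.erase j',
      θ i (Additive.ofMul (j.contractNth (· * ·) g i)) =
        (if (i : ℕ) < (j : ℕ) then θ i (Additive.ofMul (g (Fin.castSucc i))) else θ i (Additive.ofMul (g i.succ))) := by
    intro i hi
    have hij : i ≠ j' := Finset.ne_of_mem_erase hi
    have hij' : (i : ℕ) ≠ (j : ℕ) := fun h => hij (Fin.ext (h.trans hjj'.symm))
    rcases lt_or_gt_of_ne hij' with hlt | hgt
    · rw [Fin.contractNth_apply_of_lt _ _ _ _ hlt, if_pos hlt]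
    · rw [Fin.contractNth_apply_of_gt _ _ _ _ hgt, if_neg (not_lt.2 hgt.le)]
  have hrest' : ∀ i ∈ Finset.univ.erase j',
      (if (i : ℕ) < (j : ℕ) + 1 then θ i (Additive.ofMul (g (Fin.castSucc i))) else θ i (Additive.ofMul (g i.succ))) =
        (if (i : ℕ) < (j : ℕ) then θ i (Additive.ofMul (g (Fin.castSucc i))) else θ i (Additive.ofMul (g i.succ))) := by
    intro i hi
    have hij : i ≠ j' := Finset.ne_of_mem_erase hi
    have hij' : (i : ℕ) ≠ (j : ℕ) := fun h => hij (Fin.ext (h.trans hjj'.symm))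
    rcases lt_or_gt_of_ne hij' with hlt | hgt
    · rw [if_pos hlt, if_pos (Nat.lt_succ_of_lt hlt)]
    · rw [if_neg (not_lt.2 hgt.le), if_neg (by omega)]
  rw [Finset.prod_congr rfl hrest, Finset.prod_congr rfl hrest']
  rw [Fin.contractNth_apply_of_eq _ _ _ _ hjj', if_neg (lt_irrefl _), if_pos (Nat.lt_succ_self _), ofMul_mul,
    map_add]
  ring

/-- **`θ₁ ∪ ⋯ ∪ θₙ` is a cocycle** (the boundary telescopes), for coefficients in any commutative ring.
[cite: Brown1982CohomologyGroups, V §3] -/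
theorem d_charCupCochain {n : ℕ} (θ : Fin n → (Additive G →+ k)) :
    inhomogeneousCochains.d (Rep.trivial k G k) n (charCupCochain θ) = 0 := by
  funext g
  rw [inhomogeneousCochains.d_hom_apply, Fin.sum_univ_castSucc]
  change charCupCochain θ (fun i => g i.succ) + _ = 0
  rw [charCupCochain_tail, charCupCochain_contractNth_last]
  have hsum : ∑ j : Fin n, (-1 : k) ^ ((Fin.castSucc j : ℕ) + 1) • charCupCochain θ ((Fin.castSucc j).contractNth (· * ·) g) =
      ∑ j ∈ Finset.range n, ((-1 : k) ^ (j + 1) * charCupAux θ g (j + 1) - (-1 : k) ^ j * charCupAux θ g j) := by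
    rw [← Fin.sum_univ_eq_sum_range (fun j => (-1 : k) ^ (j + 1) * charCupAux θ g (j + 1) - (-1 : k) ^ j * charCupAux θ g j)]
    refine Finset.sum_congr rfl fun j _ => ?_
    rw [charCupCochain_contractNth_of_lt θ g (Fin.castSucc j) (by simp), Fin.val_castSucc, smul_eq_mul, pow_succ]
    ring
  have htel : ∑ j ∈ Finset.range n, ((-1 : k) ^ (j + 1) * charCupAux θ g (j + 1) - (-1 : k) ^ j * charCupAux θ g j) =
      (-1 : k) ^ n * charCupAux θ g n - (-1 : k) ^ 0 * charCupAux θ g 0 :=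
    Finset.sum_range_sub (fun j => (-1 : k) ^ j * charCupAux θ g j) n
  rw [hsum, htel, Fin.val_last, smul_eq_mul, pow_succ, pow_zero, one_mul]
  ring

/-- The cocycle `θ₁ ∪ ⋯ ∪ θₙ ∈ Zⁿ(G, k)`. [cite: Brown1982CohomologyGroups, V §3] -/
abbrev charCupCocycle {n : ℕ} (θ : Fin n → (Additive G →+ k)) : cocycles (Rep.trivial k G k) n :=
  cocyclesMk (charCupCochain θ) (d_charCupCochain θ)

/-- **The class `[θ₁ ∪ ⋯ ∪ θₙ] ∈ Hⁿ(G, k)`.** [cite: Brown1982CohomologyGroups, V §3] -/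
def charCupClass {n : ℕ} (θ : Fin n → (Additive G →+ k)) : groupCohomology (Rep.trivial k G k) n :=
  π (Rep.trivial k G k) n (charCupCocycle θ)

/-- The cochain underlying `charCupCocycle θ` is `charCupCochain θ`. [cite: Brown1982CohomologyGroups, V §3] -/
@[simp]
theorem iCocycles_charCupCocycle {n : ℕ} (θ : Fin n → (Additive G →+ k)) :
    iCocycles (Rep.trivial k G k) n (charCupCocycle θ) = charCupCochain θ :=
  iCocycles_mk _ _

/-- `charCupClass θ = π (charCupCocycle θ)`. [cite: Brown1982CohomologyGroups, V §3] -/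
theorem charCupClass_eq {n : ℕ} (θ : Fin n → (Additive G →+ k)) :
    charCupClass θ = π (Rep.trivial k G k) n (charCupCocycle θ) :=
  rfl

/-- **Multilinearity of the cup-product cochain**: expanding `θ'ᵢ = ∑_τ N i τ · θ τ` gives
`θ'₁ ∪ ⋯ ∪ θ'ₙ = ∑_{φ : [n] → ι} (∏ᵢ N i φ(i)) · θ_{φ(1)} ∪ ⋯ ∪ θ_{φ(n)}`. [cite: Brown1982CohomologyGroups, V §3] -/
theorem charCupCochain_sum_smul {n : ℕ} {ι : Type*} [Fintype ι] [DecidableEq ι] (θ : ι → (Additive G →+ k))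
    (N : Fin n → ι → k) :
    charCupCochain (fun i => ∑ τ, N i τ • θ τ) =
      ∑ φ : Fin n → ι, (∏ i, N i (φ i)) • charCupCochain (fun i => θ (φ i)) := by
  funext g
  rw [charCupCochain_apply, Finset.sum_apply]
  have h1 : ∀ i : Fin n, (∑ τ, N i τ • θ τ) (Additive.ofMul (g i)) = ∑ τ, N i τ * θ τ (Additive.ofMul (g i)) := by
    intro i
    rw [AddMonoidHom.finsetSum_apply]
    rfl
  simp_rw [h1]
  rw [Finset.prod_univ_sum]
  simp only [Fintype.piFinset_univ]
  refine Finset.sum_congr rfl fun φ _ => ?_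
  rw [Pi.smul_apply, smul_eq_mul, charCupCochain_apply, ← Finset.prod_mul_distrib]

/-- The same at the level of classes. [cite: Brown1982CohomologyGroups, V §3] -/
theorem charCupClass_sum_smul {n : ℕ} {ι : Type*} [Fintype ι] [DecidableEq ι] (θ : ι → (Additive G →+ k))
    (N : Fin n → ι → k) :
    charCupClass (fun i => ∑ τ, N i τ • θ τ) =
      ∑ φ : Fin n → ι, (∏ i, N i (φ i)) • charCupClass (fun i => θ (φ i)) := by
  simp only [charCupClass_eq]
  have hz : charCupCocycle (k := k) (fun i => ∑ τ, N i τ • θ τ) =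
      ∑ φ : Fin n → ι, (∏ i, N i (φ i)) • charCupCocycle (fun i => θ (φ i)) := by
    apply iCocycles_injective
    rw [map_sum, iCocycles_charCupCocycle, charCupCochain_sum_smul]
    refine Finset.sum_congr rfl fun φ _ => ?_
    rw [map_smul, iCocycles_charCupCocycle]
  rw [hz, map_sum]
  exact Finset.sum_congr rfl fun φ _ => by rw [map_smul]

/-! #### The alternating pairing with a tuple `g₁ ∧ ⋯ ∧ gₙ` -/

/-- **`⟨f, g₁ ∧ ⋯ ∧ gₙ⟩ = ∑_σ sgn(σ) f(g_{σ(1)}, …, g_{σ(n)})`**, a linear functional on `n`-cochains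
(coefficients in any commutative ring; the `[Field k]` version is `altEval` of
`AlternatingCochainEvaluation`). [cite: Brown1982CohomologyGroups, V §6] -/
def altPairing {n : ℕ} (g : Fin n → G) : ((Fin n → G) → k) →ₗ[k] k where
  toFun f := ∑ σ : Equiv.Perm (Fin n), ((Equiv.Perm.sign σ : ℤ) : k) * f (g ∘ σ)
  map_add' f f' := by
    simp only [Pi.add_apply, mul_add, Finset.sum_add_distrib]
  map_smul' a f := by
    simp only [Pi.smul_apply, smul_eq_mul, RingHom.id_apply, Finset.mul_sum]
    exact Finset.sum_congr rfl fun σ _ => by ring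

omit [Group G] in
/-- Unfolding `altPairing`. [cite: Brown1982CohomologyGroups, V §6] -/
theorem altPairing_apply {n : ℕ} (g : Fin n → G) (f : (Fin n → G) → k) :
    altPairing g f = ∑ σ : Equiv.Perm (Fin n), ((Equiv.Perm.sign σ : ℤ) : k) * f (g ∘ σ) :=
  rfl

/-- The inner faces cancel: `∑_σ sgn(σ) h(…, g_{σ(j)} g_{σ(j+1)}, …) = 0` for commuting `gᵢ`.
[folklore] -/
private theorem sum_sign_mul_contractNth_castSucc {n : ℕ} (g : Fin (n + 1) → G) (hg : ∀ a b, g a * g b = g b * g a)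
    (h : (Fin n → G) → k) (j' : Fin n) :
    ∑ σ : Equiv.Perm (Fin (n + 1)), ((Equiv.Perm.sign σ : ℤ) : k) *
      h ((Fin.castSucc j').contractNth (· * ·) (g ∘ σ)) = 0 := by
  classical
  have hne : (Fin.castSucc j' : Fin (n + 1)) ≠ j'.succ := fun h => by
    have := congrArg Fin.val h
    simp at this
  refine Finset.sum_involution (fun σ _ => σ * Equiv.swap (Fin.castSucc j') j'.succ) ?_ ?_ ?_ ?_
  · intro σ _
    rw [contractNth_comp_swap g hg σ j', Equiv.Perm.sign_mul, Equiv.Perm.sign_swap hne, ← add_mul,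
      Units.val_mul, Int.cast_mul]
    simp
  · intro σ _ _ h
    have : Equiv.swap (Fin.castSucc j') j'.succ = 1 := mul_left_cancel (h.trans (mul_one σ).symm)
    exact hne (Equiv.swap_eq_one_iff.1 this)
  · intro σ _
    exact Finset.mem_univ _
  · intro σ _
    rw [mul_assoc, Equiv.swap_mul_self, mul_one]

omit [Group G] in
/-- The outer faces match after a cyclic shift:
`∑_σ sgn(σ) h(g_{σ(1)}, …, g_{σ(n)}) = (−1)ⁿ ∑_σ sgn(σ) h(g_{σ(2)}, …, g_{σ(n+1)})`. [folklore] -/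
private theorem sum_sign_mul_init_eq {n : ℕ} (g : Fin (n + 1) → G) (h : (Fin n → G) → k) :
    ∑ σ : Equiv.Perm (Fin (n + 1)), ((Equiv.Perm.sign σ : ℤ) : k) * h (fun i => g (σ (Fin.castSucc i))) =
      (-1 : k) ^ n * ∑ σ : Equiv.Perm (Fin (n + 1)), ((Equiv.Perm.sign σ : ℤ) : k) * h (fun i => g (σ i.succ)) := by
  classical
  rw [← Fintype.sum_equiv (Equiv.mulRight (finRotate (n + 1)))
    (fun σ => ((Equiv.Perm.sign (σ * finRotate (n + 1)) : ℤ) : k) *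
      h (fun i => g ((σ * finRotate (n + 1)) (Fin.castSucc i))))
    (fun σ => ((Equiv.Perm.sign σ : ℤ) : k) * h (fun i => g (σ (Fin.castSucc i)))) (fun σ => rfl),
    Finset.mul_sum]
  refine Finset.sum_congr rfl fun σ _ => ?_
  have hrot : (fun i : Fin n => g ((σ * finRotate (n + 1)) (Fin.castSucc i))) = fun i => g (σ i.succ) := by
    funext i
    rw [Equiv.Perm.mul_apply, finRotate_apply, Fin.coeSucc_eq_succ]
  rw [hrot, Equiv.Perm.sign_mul, sign_finRotate, Nat.add_sub_cancel, Units.val_mul, Units.val_pow_eq_pow_val,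
    Units.val_neg, Units.val_one, Int.cast_mul, Int.cast_pow, Int.cast_neg, Int.cast_one]
  ring

/-- **The alternating pairing vanishes on coboundaries** at pairwise commuting `g₀, …, gₙ`
(trivial coefficients in any commutative ring). [cite: Brown1982CohomologyGroups, V §6] -/
theorem altPairing_d_eq_zero {n : ℕ} (g : Fin (n + 1) → G) (hg : ∀ a b, g a * g b = g b * g a)
    (h : (Fin n → G) → k) : altPairing g (inhomogeneousCochains.d (Rep.trivial k G k) n h) = 0 := by
  classical
  rw [altPairing_apply]
  have hd : ∀ σ : Equiv.Perm (Fin (n + 1)), inhomogeneousCochains.d (Rep.trivial k G k) n h (g ∘ σ) =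
      h (fun i => g (σ i.succ)) + ∑ j : Fin (n + 1), (-1 : k) ^ ((j : ℕ) + 1) * h (j.contractNth (· * ·) (g ∘ σ)) := by
    intro σ
    rw [inhomogeneousCochains.d_hom_apply]
    rfl
  simp_rw [hd, mul_add, Finset.sum_add_distrib, Finset.mul_sum]
  rw [Finset.sum_comm]
  simp_rw [mul_left_comm _ ((-1 : k) ^ _), ← Finset.mul_sum]
  rw [Fin.sum_univ_castSucc]
  simp_rw [sum_sign_mul_contractNth_castSucc g hg h, mul_zero, Finset.sum_const_zero, zero_add]
  have hinit : ∀ σ : Equiv.Perm (Fin (n + 1)), (Fin.last n).contractNth (· * ·) (g ∘ σ) =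
      fun i => g (σ (Fin.castSucc i)) := fun σ => by
    funext i
    rw [Fin.contractNth_apply_of_lt _ _ _ _ (by simp)]
    rfl
  simp_rw [hinit]
  rw [sum_sign_mul_init_eq, Fin.val_last, ← mul_assoc, ← pow_add,
    show n + 1 + n = 2 * n + 1 by ring, pow_succ, pow_mul]
  simp

/-- **`⟨θ₁ ∪ ⋯ ∪ θₙ, g₁ ∧ ⋯ ∧ gₙ⟩ = det (θᵢ(g_a))_{a,i}`.** [cite: Brown1982CohomologyGroups, V §6] -/
theorem altPairing_charCupCochain {n : ℕ} (g : Fin n → G) (θ : Fin n → (Additive G →+ k)) :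
    altPairing g (charCupCochain θ) = (Matrix.of fun a i => θ i (Additive.ofMul (g a))).det := by
  rw [altPairing_apply, Matrix.det_apply]
  refine Finset.sum_congr rfl fun σ _ => ?_
  rw [Units.smul_def, zsmul_eq_mul, charCupCochain_apply]
  rfl

/-- **Dual pairs give the identity matrix**: if `θ'ⱼ(b_l) = δ_{jl}` then for `n`-subsets `I, J`
(strictly increasing `Fin n ↪o Fin d`), `⟨θ'_{I(1)} ∪ ⋯ ∪ θ'_{I(n)}, b_{J(1)} ∧ ⋯ ∧ b_{J(n)}⟩ = δ_{IJ}`.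
[cite: Brown1982CohomologyGroups, V §6] -/
theorem altPairing_charCupCochain_dual {d n : ℕ} [DecidableEq (Fin n ↪o Fin d)] (b : Fin d → G)
    (θ' : Fin d → (Additive G →+ k))
    (hdual : ∀ j l, θ' j (Additive.ofMul (b l)) = if j = l then 1 else 0) (I J : Fin n ↪o Fin d) :
    altPairing (b ∘ J) (charCupCochain fun i => θ' (I i)) = if I = J then 1 else 0 := by
  classical
  rw [altPairing_charCupCochain]
  by_cases hIJ : I = J
  · subst hIJ
    rw [if_pos rfl]
    have hM : (Matrix.of fun a i => θ' (I i) (Additive.ofMul ((b ∘ I) a))) = (1 : Matrix (Fin n) (Fin n) k) := by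
      ext a i
      rw [Matrix.of_apply, Function.comp_apply, hdual, Matrix.one_apply]
      by_cases hai : a = i
      · subst hai; simp
      · rw [if_neg (fun h => hai (I.injective h).symm), if_neg hai]
    rw [hM, Matrix.det_one]
  · rw [if_neg hIJ]
    have hex : ∃ a, ∀ i, I i ≠ J a := by
      by_contra hcon
      push Not at hcon
      apply hIJ
      have hsub : Finset.univ.image J ⊆ Finset.univ.image I := by
        intro x hx
        obtain ⟨a, -, rfl⟩ := Finset.mem_image.1 hx
        obtain ⟨i, hi⟩ := hcon a
        exact Finset.mem_image.2 ⟨i, Finset.mem_univ _, hi⟩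
      have hcard : (Finset.univ.image I).card ≤ (Finset.univ.image J).card := by
        rw [Finset.card_image_of_injective _ I.injective, Finset.card_image_of_injective _ J.injective]
      have heq := Finset.eq_of_subset_of_card_le hsub hcard
      have hrange : Set.range J = Set.range I := by
        rw [← Set.image_univ, ← Set.image_univ, ← Finset.coe_univ, ← Finset.coe_image, ← Finset.coe_image, heq]
      exact (OrderEmbedding.range_inj.1 hrange.symm)
    obtain ⟨a, ha⟩ := hex
    refine Matrix.det_eq_zero_of_row_eq_zero a fun i => ?_
    rw [Matrix.of_apply, Function.comp_apply, hdual, if_neg (ha i)]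

end CupCochains

/-! ### §4 The alternating pairing on `Hⁿ(G, k)` and the cup-product basis (`G` commutative) -/

section Basis

variable {k G : Type u} [CommRing k] [CommGroup G]

/-- For a commutative group the alternating pairing of a cocycle with `g₁ ∧ ⋯ ∧ gₙ` depends only on
its class (it kills coboundaries, `altPairing_d_eq_zero`). [cite: Brown1982CohomologyGroups, V §6] -/
theorem altPairing_iCocycles_eq_of_π_eq {n : ℕ} (g : Fin n → G) {z z' : cocycles (Rep.trivial k G k) n}
    (h : π (Rep.trivial k G k) n z = π (Rep.trivial k G k) n z') :
    altPairing g (iCocycles (Rep.trivial k G k) n z) = altPairing g (iCocycles (Rep.trivial k G k) n z') := by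
  obtain ⟨w, hw⟩ := (π_apply_eq_π_apply_iff (Rep.trivial k G k) n z z').1 h
  rw [← sub_eq_zero, ← map_sub, ← map_sub, ← hw, iCocycles_toCocycles]
  cases n with
  | zero =>
    have h0 : (inhomogeneousCochains (Rep.trivial k G k)).d (0 - 1) 0 = 0 :=
      HomologicalComplex.shape _ _ _ (by simp)
    rw [h0]
    simp
  | succ m =>
    have hd : (inhomogeneousCochains (Rep.trivial k G k)).d (m + 1 - 1) (m + 1) =
        inhomogeneousCochains.d (Rep.trivial k G k) m := inhomogeneousCochains.d_def (Rep.trivial k G k) m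
    rw [hd]
    exact altPairing_d_eq_zero g (fun a c => mul_comm _ _) w

/-- The alternating pairing on classes, through a chosen representing cocycle (auxiliary). [folklore] -/
private def altPairingClassFun {n : ℕ} (g : Fin n → G) (x : groupCohomology (Rep.trivial k G k) n) : k :=
  altPairing g (iCocycles (Rep.trivial k G k) n (Classical.choose (π_surjective (Rep.trivial k G k) n x)))

/-- `altPairingClassFun g [z] = ⟨z, g₁ ∧ ⋯ ∧ gₙ⟩`. [folklore] -/
private theorem altPairingClassFun_π {n : ℕ} (g : Fin n → G) (z : cocycles (Rep.trivial k G k) n) :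
    altPairingClassFun g (π (Rep.trivial k G k) n z) = altPairing g (iCocycles (Rep.trivial k G k) n z) :=
  altPairing_iCocycles_eq_of_π_eq g (Classical.choose_spec (π_surjective (Rep.trivial k G k) n (π _ n z)))

/-- **The alternating pairing `Hⁿ(G, k) → k`, `[f] ↦ ∑_σ sgn(σ) f(g_{σ(1)}, …, g_{σ(n)})`** with a
tuple `g₁ ∧ ⋯ ∧ gₙ` of a commutative group (the pairing with the Pontryagin product
`g₁ ∧ ⋯ ∧ gₙ ∈ ⋀ⁿ G ⊆ Hₙ(G)`), `k`-linear. [cite: Brown1982CohomologyGroups, V §6] -/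
def altPairingClass {n : ℕ} (g : Fin n → G) : groupCohomology (Rep.trivial k G k) n →ₗ[k] k where
  toFun := altPairingClassFun g
  map_add' x y := by
    induction x using groupCohomology_induction_on with
    | h z =>
      induction y using groupCohomology_induction_on with
      | h z' =>
        rw [← map_add, altPairingClassFun_π, altPairingClassFun_π, altPairingClassFun_π, map_add, map_add]
  map_smul' c x := by
    induction x using groupCohomology_induction_on with
    | h z =>
      rw [← map_smul, altPairingClassFun_π, altPairingClassFun_π, map_smul, map_smul, RingHom.id_apply]

/-- **`⟨[z], g₁ ∧ ⋯ ∧ gₙ⟩ = ∑_σ sgn(σ) z(g ∘ σ)`.** [cite: Brown1982CohomologyGroups, V §6] -/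
@[simp]
theorem altPairingClass_π {n : ℕ} (g : Fin n → G) (z : cocycles (Rep.trivial k G k) n) :
    altPairingClass g (π (Rep.trivial k G k) n z) = altPairing g (iCocycles (Rep.trivial k G k) n z) :=
  altPairingClassFun_π g z

/-- `⟨[θ₁ ∪ ⋯ ∪ θₙ], g₁ ∧ ⋯ ∧ gₙ⟩ = det (θᵢ(g_a))`. [cite: Brown1982CohomologyGroups, V §6] -/
theorem altPairingClass_charCupClass {n : ℕ} (g : Fin n → G) (θ : Fin n → (Additive G →+ k)) :
    altPairingClass g (charCupClass θ) = (Matrix.of fun a i => θ i (Additive.ofMul (g a))).det := by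
  rw [charCupClass_eq, altPairingClass_π, iCocycles_charCupCocycle, altPairing_charCupCochain]

variable {d : ℕ} (b : Fin d → G)

/-- **The alternating evaluation `Hⁿ(G, k) → k^{(n-subsets of [d])}`**, `[f] ↦ (⟨[f], b_s⟩)_s` at the
increasing `n`-tuples `b_s = b_{s₁} ∧ ⋯ ∧ b_{sₙ}` of a family `b : Fin d → G`.
[cite: Brown1982CohomologyGroups, V §6] -/
def altPairingHom (n : ℕ) :
    groupCohomology (Rep.trivial k G k) n →ₗ[k] (Finset.powersetCard n (Finset.univ : Finset (Fin d)) → k) :=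
  LinearMap.pi fun s => altPairingClass (b ∘ subsetEmb s)

/-- Components of `altPairingHom`. [cite: Brown1982CohomologyGroups, V §6] -/
@[simp]
theorem altPairingHom_apply (n : ℕ) (x : groupCohomology (Rep.trivial k G k) n)
    (s : Finset.powersetCard n (Finset.univ : Finset (Fin d))) :
    altPairingHom b n x s = altPairingClass (b ∘ subsetEmb s) x :=
  rfl

variable (θ' : Fin d → (Additive G →+ k)) (hdual : ∀ j l, θ' j (Additive.ofMul (b l)) = if j = l then 1 else 0)

/-- The cup class of the dual characters indexed by an `n`-subset `I`: `[θ'_{I₁} ∪ ⋯ ∪ θ'_{Iₙ}]`.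
[cite: Brown1982CohomologyGroups, V §6] -/
def dualCupClass (n : ℕ) (I : Finset.powersetCard n (Finset.univ : Finset (Fin d))) :
    groupCohomology (Rep.trivial k G k) n :=
  charCupClass fun i => θ' (subsetEmb I i)

include hdual in
/-- **Dual cup classes evaluate to the standard basis vectors**: `⟨[θ'_I], b_s⟩ = δ_{I s}`.
[cite: Brown1982CohomologyGroups, V §6] -/
theorem altPairingHom_dualCupClass (n : ℕ) (I : Finset.powersetCard n (Finset.univ : Finset (Fin d))) :
    altPairingHom b n (dualCupClass θ' n I) = Pi.single I 1 := by
  classical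
  funext s
  rw [altPairingHom_apply, dualCupClass, charCupClass_eq, altPairingClass_π, iCocycles_charCupCocycle,
    altPairing_charCupCochain_dual b θ' hdual (subsetEmb I) (subsetEmb s), Pi.single_apply]
  by_cases hIs : s = I
  · subst hIs; simp
  · rw [if_neg (fun h => hIs (subsetEmb_injective h).symm), if_neg hIs]

include hdual in
/-- **Surjectivity of the alternating evaluation** (given characters dual to `b`).
[cite: Brown1982CohomologyGroups, V §6] -/
theorem altPairingHom_surjective (n : ℕ) : Function.Surjective (altPairingHom (k := k) b n) := by
  classical
  intro v
  refine ⟨∑ I, v I • dualCupClass θ' n I, ?_⟩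
  rw [map_sum]
  simp_rw [map_smul, altPairingHom_dualCupClass b θ' hdual]
  funext s
  rw [Finset.sum_apply]
  simp_rw [Pi.smul_apply, Pi.single_apply, smul_eq_mul, mul_ite, mul_one, mul_zero]
  simp [Finset.sum_ite_eq]

/-- The number of `n`-subsets of `Fin d` is `(d choose n)`. [folklore] -/
private theorem card_powersetCard_univ_fin (d n : ℕ) :
    Fintype.card (Finset.powersetCard n (Finset.univ : Finset (Fin d))) = d.choose n := by
  rw [Fintype.card_coe, Finset.card_powersetCard, Finset.card_univ, Fintype.card_fin]

variable (hgen : ∀ g : G, ∃ m : Fin d → ℤ, g = ∏ l, b l ^ m l)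
  (hind : ∀ m : Fin d → ℤ, ∏ l, b l ^ m l = 1 → m = 0)

include hgen hind hdual in
/-- **The alternating evaluation `Hⁿ(G, k) ⥲ k^{(d choose n)}` is bijective** for a commutative group
with `ℤ`-basis `b` and ANY commutative coefficient ring `k`: it is surjective (dual cup classes) from a
module which is itself free of rank `(d choose n)` (§2), hence injective (a surjection between
finitely generated modules of the same free rank is a bijection — Orzech / Vasconcelos). Over
`k = ℤ` this is the cohomological form of Brown's Thm. V.6.4 (ii) for the torsion-free group `ℤ^d`.
[cite: Brown1982CohomologyGroups, V §6] -/
theorem altPairingHom_bijective (n : ℕ) : Function.Bijective (altPairingHom (k := k) b n) := by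
  have hsurj := altPairingHom_surjective b θ' hdual n
  obtain ⟨e⟩ := nonempty_linearEquiv_finArrow (k := k) b hind hgen n
  let σ : Finset.powersetCard n (Finset.univ : Finset (Fin d)) ≃ Fin (d.choose n) :=
    Fintype.equivFinOfCardEq (card_powersetCard_univ_fin d n)
  let e' : groupCohomology (Rep.trivial k G k) n ≃ₗ[k] (Finset.powersetCard n (Finset.univ : Finset (Fin d)) → k) :=
    e.trans (LinearEquiv.funCongrLeft k k σ)
  exact ⟨OrzechProperty.injective_of_surjective_of_injective e'.toLinearMap (altPairingHom b n) e'.injective hsurj,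
    hsurj⟩

include θ' hdual hgen hind in
/-- **`Hⁿ(G, k) ≃ₗ k^{(n-subsets of [d])}` by alternating evaluation** at the basis tuples.
[cite: Brown1982CohomologyGroups, V §6] -/
def altPairingEquiv (n : ℕ) :
    groupCohomology (Rep.trivial k G k) n ≃ₗ[k] (Finset.powersetCard n (Finset.univ : Finset (Fin d)) → k) :=
  LinearEquiv.ofBijective (altPairingHom b n) (altPairingHom_bijective b θ' hdual hgen hind n)

/-- `altPairingEquiv` is `altPairingHom`. [cite: Brown1982CohomologyGroups, V §6] -/
@[simp]
theorem altPairingEquiv_apply (n : ℕ) (x : groupCohomology (Rep.trivial k G k) n) :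
    altPairingEquiv b θ' hdual hgen hind n x = altPairingHom b n x :=
  rfl

include θ' hdual hgen hind in
/-- **Two classes with the same alternating evaluations at the basis tuples are equal**
(injectivity, the form used downstream). [cite: Brown1982CohomologyGroups, V §6] -/
theorem eq_of_altPairingClass_eq (n : ℕ) {x y : groupCohomology (Rep.trivial k G k) n}
    (h : ∀ s : Finset.powersetCard n (Finset.univ : Finset (Fin d)),
      altPairingClass (b ∘ subsetEmb s) x = altPairingClass (b ∘ subsetEmb s) y) : x = y :=
  (altPairingHom_bijective b θ' hdual hgen hind n).1 (funext fun s => by rw [altPairingHom_apply, altPairingHom_apply, h s])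

include θ' hdual hgen hind in
/-- **THE CUP-PRODUCT BASIS of `Hⁿ(G, k)`**: the `(d choose n)` classes `[θ'_{s₁} ∪ ⋯ ∪ θ'_{sₙ}]`,
`s` an `n`-subset of `[d]`, for characters `θ'` dual to the `ℤ`-basis `b` — over any commutative
`k`; for `k = ℤ`, `G = ℤ^d`: `H•(ℤ^d, ℤ) = ⋀•(ℤ^d)^∨` with its monomial basis.
[cite: Brown1982CohomologyGroups, V §6] -/
def dualCupBasis (n : ℕ) :
    Module.Basis (Finset.powersetCard n (Finset.univ : Finset (Fin d))) k (groupCohomology (Rep.trivial k G k) n) :=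
  (Pi.basisFun k _).map (altPairingEquiv b θ' hdual hgen hind n).symm

/-- The basis vectors are the dual cup classes. [cite: Brown1982CohomologyGroups, V §6] -/
@[simp]
theorem dualCupBasis_apply (n : ℕ) (s : Finset.powersetCard n (Finset.univ : Finset (Fin d))) :
    dualCupBasis b θ' hdual hgen hind n s = dualCupClass θ' n s := by
  rw [dualCupBasis, Module.Basis.map_apply, Pi.basisFun_apply, LinearEquiv.symm_apply_eq, altPairingEquiv_apply,
    altPairingHom_dualCupClass b θ' hdual]

/-- The coordinates in the cup basis are the alternating evaluations. [cite: Brown1982CohomologyGroups, V §6] -/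
theorem dualCupBasis_repr_apply (n : ℕ) (x : groupCohomology (Rep.trivial k G k) n)
    (s : Finset.powersetCard n (Finset.univ : Finset (Fin d))) :
    (dualCupBasis b θ' hdual hgen hind n).repr x s = altPairingClass (b ∘ subsetEmb s) x := by
  rw [dualCupBasis, Module.Basis.map_repr, LinearEquiv.trans_apply, LinearEquiv.symm_symm, altPairingEquiv_apply,
    Pi.basisFun_repr, altPairingHom_apply]

include hgen hind hdual in
/-- `Hⁿ(G, k)` is a free `k`-module. [cite: Brown1982CohomologyGroups, V §6] -/
theorem free_groupCohomology (n : ℕ) : Module.Free k (groupCohomology (Rep.trivial k G k) n) :=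
  Module.Free.of_basis (dualCupBasis b θ' hdual hgen hind n)

include hgen hind hdual in
/-- `Hⁿ(G, k)` is finitely generated. [cite: Brown1982CohomologyGroups, V §6] -/
theorem finite_groupCohomology (n : ℕ) : Module.Finite k (groupCohomology (Rep.trivial k G k) n) :=
  Module.Finite.of_basis (dualCupBasis b θ' hdual hgen hind n)

include hgen hind hdual in
/-- **`rank_k Hⁿ(G, k) = (d choose n)`** (`k` nontrivial). [cite: Brown1982CohomologyGroups, V §6] -/
theorem finrank_groupCohomology [Nontrivial k] (n : ℕ) :
    Module.finrank k (groupCohomology (Rep.trivial k G k) n) = d.choose n := by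
  rw [Module.finrank_eq_card_basis (dualCupBasis b θ' hdual hgen hind n), card_powersetCard_univ_fin]

end Basis

/-! ### §5 Coordinate characters of a based commutative group -/

section Coord

variable {G : Type u} [CommGroup G] {d : ℕ} (b : Fin d → G)
  (hgen : ∀ g : G, ∃ m : Fin d → ℤ, g = ∏ l, b l ^ m l)
  (hind : ∀ m : Fin d → ℤ, ∏ l, b l ^ m l = 1 → m = 0)

/-- The exponent vector of `g = ∏ b_l^{m_l}` (a choice; unique by `hind`). [folklore] -/
private def coordExp (g : G) : Fin d → ℤ :=
  Classical.choose (hgen g)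

/-- `∏ b_l^{(coordExp g) l} = g`. [folklore] -/
private theorem prod_zpow_coordExp (g : G) : ∏ l, b l ^ coordExp b hgen g l = g :=
  (Classical.choose_spec (hgen g)).symm

include hind in
/-- Uniqueness of exponents. [folklore] -/
private theorem coordExp_eq_of_eq_prod {g : G} {m : Fin d → ℤ} (h : g = ∏ l, b l ^ m l) : coordExp b hgen g = m := by
  have h1 : ∏ l, b l ^ (coordExp b hgen g - m) l = 1 := by
    calc ∏ l, b l ^ (coordExp b hgen g - m) l = (∏ l, b l ^ coordExp b hgen g l) * (∏ l, b l ^ m l)⁻¹ := by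
          rw [← Finset.prod_inv_distrib, ← Finset.prod_mul_distrib]
          exact Finset.prod_congr rfl fun l _ => by rw [Pi.sub_apply, zpow_sub]
      _ = 1 := by rw [prod_zpow_coordExp, ← h, mul_inv_cancel]
  exact sub_eq_zero.1 (hind _ h1)

include hind in
/-- Exponents are additive. [folklore] -/
private theorem coordExp_mul (g g' : G) : coordExp b hgen (g * g') = coordExp b hgen g + coordExp b hgen g' := by
  refine coordExp_eq_of_eq_prod b hgen hind ?_
  rw [prod_zpow_add', prod_zpow_coordExp, prod_zpow_coordExp]

variable (k : Type u) [CommRing k]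

/-- **The coordinate characters `θⱼ(∏ b_l^{m_l}) = m_j`** of a commutative group with `ℤ`-basis `b`,
with values in `k`. [folklore] -/
def coordChar (j : Fin d) : Additive G →+ k where
  toFun x := (coordExp b hgen x.toMul j : k)
  map_zero' := by
    change ((coordExp b hgen (1 : G) j : ℤ) : k) = 0
    rw [coordExp_eq_of_eq_prod b hgen hind (m := 0) (by simp), Pi.zero_apply, Int.cast_zero]
  map_add' x y := by
    change ((coordExp b hgen (x.toMul * y.toMul) j : ℤ) : k) = (coordExp b hgen x.toMul j : k) + (coordExp b hgen y.toMul j : k)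
    rw [coordExp_mul b hgen hind, Pi.add_apply, Int.cast_add]

/-- **`θⱼ(∏ b_l^{m_l}) = m_j`.** [cite: Brown1982CohomologyGroups, V §6 (p. 129)] -/
theorem coordChar_ofMul_prod (j : Fin d) (m : Fin d → ℤ) :
    coordChar b hgen hind k j (Additive.ofMul (∏ l, b l ^ m l)) = (m j : k) := by
  change ((coordExp b hgen (∏ l, b l ^ m l) j : ℤ) : k) = (m j : k)
  rw [coordExp_eq_of_eq_prod b hgen hind rfl]

/-- **The coordinate characters are dual to the basis**: `θⱼ(b_l) = δ_{jl}`. [cite: Brown1982CohomologyGroups, V §6 (p. 129)] -/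
theorem coordChar_basis (j l : Fin d) :
    coordChar b hgen hind k j (Additive.ofMul (b l)) = if j = l then 1 else 0 := by
  rw [← zpow_one (b l), ← prod_zpow_single' b l 1, coordChar_ofMul_prod, Pi.single_apply]
  split_ifs <;> simp

/-- **`Hⁿ(ℤ^d, k)` has the basis of cup products of coordinate characters** (no auxiliary data).
[cite: Brown1982CohomologyGroups, V §6] -/
def coordCupBasis (n : ℕ) :
    Module.Basis (Finset.powersetCard n (Finset.univ : Finset (Fin d))) k (groupCohomology (Rep.trivial k G k) n) :=
  dualCupBasis b (coordChar b hgen hind k) (coordChar_basis b hgen hind k) hgen hind n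

/-- Its vectors: `[θ_{s₁} ∪ ⋯ ∪ θ_{sₙ}]` for the coordinate characters `θ`. [cite: Brown1982CohomologyGroups, V §6] -/
theorem coordCupBasis_apply (n : ℕ) (s : Finset.powersetCard n (Finset.univ : Finset (Fin d))) :
    coordCupBasis b hgen hind k n s = charCupClass fun i => coordChar b hgen hind k (subsetEmb s i) :=
  dualCupBasis_apply _ _ _ _ _ _ _

include hgen hind in
/-- **`Hⁿ(G, k)` is free of rank `(d choose n)`** for a commutative group `G` with a `ℤ`-basis of `d`
elements, over any nontrivial commutative `k` — e.g. `rank_ℤ Hⁿ(ℤ^d, ℤ) = (d choose n)`.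
[cite: Brown1982CohomologyGroups, V §6] -/
theorem free_and_finrank_groupCohomology [Nontrivial k] (n : ℕ) :
    Module.Free k (groupCohomology (Rep.trivial k G k) n) ∧
      Module.finrank k (groupCohomology (Rep.trivial k G k) n) = d.choose n :=
  ⟨free_groupCohomology b (coordChar b hgen hind k) (coordChar_basis b hgen hind k) hgen hind n,
    finrank_groupCohomology b (coordChar b hgen hind k) (coordChar_basis b hgen hind k) hgen hind n⟩

end Coord

end Literature.Algebra.Homology

end
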